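import Summits.HodgeConjecture.HodgeConjecture.Theorems.BoundaryReadoutHCOverNumberFieldsTransfer
import Summits.HodgeConjecture.HodgeConjecture.Theses.AdelicCoherence
import Literature.AlgebraicGeometry.HodgeTheory.HardLefschetzNFoldHolds
import Literature.AlgebraicGeometry.HodgeTheory.ComplexConjugationHolds
import HarnessLib

/-!
# Route BoundaryReadout — crux `HCOverNumberFields` (stmt-HodgeConjecture-1070): the number-field-typed
# form of route `AdelicCoherence` (stmt-HodgeConjecture-13516), and the reduction to the deep middle range

Helper file for the crux item stmt-HodgeConjecture-1070 (it closes nothing; the crux is the Hodge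
conjecture for smooth projective complex varieties definable over a number field, an open problem).
Two theorems that pin the item's exact extent:

1. **The third live spelling is the same statement.** Route `AdelicCoherence` types "HC for
   number-field varieties" as its TARGET `HodgeConjectureNumberFields` (stmt-HodgeConjecture-13516):
   `∀ k [NumberField k] (ρ : k →+* ℂ) n (X : SchemeOver k), IsSmoothProjective n X →
   IsSmoothProjective n (X ⊗_ρ ℂ) → HodgeConjectureFor n (X ⊗_ρ ℂ)`. We prove
   `hcOverNumberFields_iff_hodgeConjectureNumberFields : BoundaryReadout.HCOverNumberFields ↔
   AdelicCoherence.HodgeConjectureNumberFields`. The direction crux ⇒ target is instantiation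
   (`X ⊗_ρ ℂ ≅ X ⊗_ρ ℂ`); the direction target ⇒ crux needs the hypothesis `IsSmoothProjective n X₀`
   OVER THE NUMBER FIELD, which the crux does not carry: it is supplied by DESCENT of "smooth
   projective geometrically irreducible of dimension `n`" along `Spec ℂ → Spec K`
   (`isSmoothProjective_of_baseChangeHom`: fpqc descent of smoothness, EGA IV 17.7.3; projectivity
   descends, Görtz–Wedhorn I Prop. 14.57; geometric irreducibility), after transporting smooth
   projectivity and `HodgeConjectureFor` along the given isomorphism `X ≅ X₀ ⊗_{K,σ} ℂ`
   (`IsSmoothProjective.of_iso`, `hodgeConjectureFor_transport_of_iso`). Together with the landed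
   transfer `hcOverNumberFields_iff_hodgeConjectureQbar` (file `BoundaryReadoutHCOverNumberFieldsTransfer`)
   the three items stmt-1070, stmt-11596 (`PeriodDeficiency.HodgeConjectureQbar`) and stmt-13516 are ONE
   open problem (`hodgeConjectureNumberFields_iff_hodgeConjectureQbar`).
2. **Reduction to the deep middle range.** On a smooth projective complex `n`-fold the cycle clause of
   the Hodge conjecture is a THEOREM of the tree for `p ≤ 1 ∨ n ≤ p + 1` (Lefschetz `(1,1)` + hard
   Lefschetz, `hcOverNumberFields_lefschetzRange`) and, by hard Lefschetz
   (`HardLefschetzNFold.mem_algebraicClasses_of_lt_holds`, Voisin I Thm. 6.25 / Kerr–Pearlstein §3.1),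
   codimension `p` with `n < 2p` follows from codimension `n - p`. Hence
   `hcOverNumberFields_iff_deepMiddle`: the crux is EQUIVALENT to its restriction to classes of
   codimension `p` with `2 ≤ p` and `2p ≤ n` on arithmetic varieties (so `n ≥ 4`; the first open case
   is `p = 2` on arithmetic fourfolds, the decisive known-open family being Weil classes on CM abelian
   varieties of Weil type). The Hodge-model conjunct of `HodgeConjectureFor` is the discharged tree
   theorem `nonempty_hodgeModel_holds`.

No definition, no named-fact hypothesis, no `sorry`; standard axioms.

## References

* [GortzWedhorn2020] U. Görtz, T. Wedhorn, Algebraic Geometry I (2nd ed., 2020), Prop. 14.57.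
* [EGAIV3] A. Grothendieck, ÉGA IV, 17.7.3 (ii) (descent of smoothness), 8.8.2 (ii).
* [VoisinHodgeI2002] C. Voisin, Hodge Theory and Complex Algebraic Geometry I, Thm. 6.25, Rem. 6.27,
  §7.1.2, Thm. 11.30.
* [KerrPearlstein2011] M. Kerr, G. Pearlstein, An exponential history of functions with logarithmic
  growth, MSRI Publ. 58 (2011), §3.1.
* [Voisin2007HodgeLoci] C. Voisin, Hodge loci and absolute Hodge classes, Compositio 143 (2007), Rem. 1.4.
-/

-- every declaration of this problem lives in `Summit.HodgeConjecture.HodgeConjecture.…` (summit = sub-problem)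
set_option linter.dupNamespace false

noncomputable section

namespace Summit.HodgeConjecture.HodgeConjecture.Theorems

open CategoryTheory AlgebraicGeometry
open Literature.AlgebraicGeometry.Motives Literature.AlgebraicGeometry.HodgeTheory
open Summit.HodgeConjecture.HodgeConjecture.Theses

/-! ### 1. The crux is the target of route `AdelicCoherence` -/

/-- **Crux ⇒ target of `AdelicCoherence`.** If the Hodge conjecture holds for every smooth projective
complex variety definable over a number field (`BoundaryReadout.HCOverNumberFields`, stmt-1070), then it
holds for every `X ⊗_{k,ρ} ℂ` with `X` smooth projective over a number field `k`
(`AdelicCoherence.HodgeConjectureNumberFields`, stmt-13516): the witness of definability is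
`X ⊗_ρ ℂ` itself with the identity isomorphism. A CONDITIONAL result (its hypothesis is the open crux).
[cite: Voisin2007HodgeLoci, Rem. 1.4] -/
theorem hodgeConjectureNumberFields_of_hcOverNumberFields (h : BoundaryReadout.HCOverNumberFields) :
    AdelicCoherence.HodgeConjectureNumberFields := by
  unfold AdelicCoherence.HodgeConjectureNumberFields
  intro k _ _ ρ n X _ hX
  exact h hX ⟨k, inferInstance, inferInstance, ρ, X, ⟨Iso.refl _⟩⟩

/-- **Target of `AdelicCoherence` ⇒ crux.** If the Hodge conjecture holds for every `X₀ ⊗_{K,σ} ℂ`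
with `X₀` smooth projective over a number field `K` (stmt-13516), then it holds for every smooth
projective complex `X` with `X ≅ X₀ ⊗_{K,σ} ℂ` (stmt-1070): `X₀ ⊗_σ ℂ` is smooth projective of
dimension `n` by transport along the isomorphism (`IsSmoothProjective.of_iso`), hence SO IS `X₀` OVER
`K` by descent (`isSmoothProjective_of_baseChangeHom`: fpqc descent of smoothness and of the relative
dimension, descent of projectivity, Görtz–Wedhorn I Prop. 14.57, and of geometric irreducibility), and
`HodgeConjectureFor` transports back along the isomorphism (`hodgeConjectureFor_transport_of_iso`).
A CONDITIONAL result. [cite: GortzWedhorn2020, Prop. 14.57] -/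
theorem hcOverNumberFields_of_hodgeConjectureNumberFields
    (h : AdelicCoherence.HodgeConjectureNumberFields) : BoundaryReadout.HCOverNumberFields := by
  unfold BoundaryReadout.HCOverNumberFields
  rintro n X hX ⟨K, _, _, σ, X₀, ⟨e⟩⟩
  have hXσ : IsSmoothProjective n ((baseChangeHom σ).obj X₀) := hX.of_iso e
  have hX₀ : IsSmoothProjective n X₀ := isSmoothProjective_of_baseChangeHom σ X₀ hXσ
  exact hodgeConjectureFor_transport_of_iso e (h σ hX₀ hXσ)

/-- **stmt-HodgeConjecture-1070 ⟺ stmt-HodgeConjecture-13516.** The crux `HCOverNumberFields` of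
routes `BoundaryReadout`/`QbarEnvelope` and the target `HodgeConjectureNumberFields` of route
`AdelicCoherence` are one statement: the Hodge conjecture for smooth projective complex varieties
definable over a number field. [cite: Voisin2007HodgeLoci, Rem. 1.4] [cite: GortzWedhorn2020, Prop. 14.57] -/
theorem hcOverNumberFields_iff_hodgeConjectureNumberFields :
    BoundaryReadout.HCOverNumberFields ↔ AdelicCoherence.HodgeConjectureNumberFields :=
  ⟨hodgeConjectureNumberFields_of_hcOverNumberFields, hcOverNumberFields_of_hodgeConjectureNumberFields⟩

/-- **stmt-HodgeConjecture-13516 ⟺ stmt-HodgeConjecture-11596.** The number-field-typed target of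
`AdelicCoherence` and the `ℚ̄`-typed crux `PeriodDeficiency.HodgeConjectureQbar` are one statement
(through `hcOverNumberFields_iff_hodgeConjectureQbar`): all three live spellings of "the Hodge
conjecture for arithmetic varieties" in the hub coincide. [cite: Voisin2007HodgeLoci, Rem. 1.4]
[cite: EGAIV3, Thm. 8.8.2 (ii)] -/
theorem hodgeConjectureNumberFields_iff_hodgeConjectureQbar :
    AdelicCoherence.HodgeConjectureNumberFields ↔ PeriodDeficiency.HodgeConjectureQbar :=
  hcOverNumberFields_iff_hodgeConjectureNumberFields.symm.trans hcOverNumberFields_iff_hodgeConjectureQbar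

/-! ### 2. Reduction of the crux to the deep middle range `2 ≤ p ≤ n / 2` -/

/-- **Hard-Lefschetz folding of the cycle clause on one variety.** On a smooth projective complex
`n`-fold, if every rational `(q,q)` class with `2 ≤ q` and `2q ≤ n` is algebraic, then every rational
`(p,p)` class is algebraic in EVERY codimension `p`: the Lefschetz range `p ≤ 1 ∨ n ≤ p + 1` is the
tree theorem `hcOverNumberFields_lefschetzRange` (Lefschetz `(1,1)`, hard Lefschetz, `p > n`), the deep
middle range is the hypothesis, and `n < 2p ≤ 2n - 4` is folded onto codimension `n - p` (which has
`2 ≤ n - p`, `2(n - p) ≤ n`) by `HardLefschetzNFold.mem_algebraicClasses_of_lt_holds`. No definability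
hypothesis is used. [cite: VoisinHodgeI2002, Thm. 6.25, Rem. 6.27 and §7.1.2]
[cite: KerrPearlstein2011, §3.1] -/
theorem hodgeClasses_algebraic_of_deepMiddle {n : ℕ} {X : SchemeOver ℂ} (hX : IsSmoothProjective n X)
    (hmid : ∀ (q : ℕ), 2 ≤ q → 2 * q ≤ n → ∀ (c : complexBetti X (2 * q)), IsRationalClass c →
      IsOfHodgeType n X (2 * q) q q c → c ∈ algebraicClasses X q)
    (p : ℕ) (c : complexBetti X (2 * p)) (hc : IsRationalClass c)
    (hpp : IsOfHodgeType n X (2 * p) p p c) : c ∈ algebraicClasses X p := by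
  by_cases hp : p ≤ 1 ∨ n ≤ p + 1
  · exact hcOverNumberFields_lefschetzRange hX p hp c hc hpp
  · by_cases h2 : 2 * p ≤ n
    · exact hmid p (by omega) h2 c hc hpp
    · exact HardLefschetzNFold.mem_algebraicClasses_of_lt_holds hX (by omega)
        (fun c' hc' hqq ↦ hmid (n - p) (by omega) (by omega) c' hc' hqq) c hc hpp

/-- **The crux reduced to the deep middle range.** `HCOverNumberFields` is EQUIVALENT to: on every
smooth projective complex `n`-fold definable over a number field, every rational `(p,p)` class with
`2 ≤ p` and `2p ≤ n` is algebraic. (`⇒` is specialisation; `⇐` is `hodgeClasses_algebraic_of_deepMiddle`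
variety by variety, the Hodge-model conjunct of `HodgeConjectureFor` being the discharged theorem
`nonempty_hodgeModel_holds`.) In particular the open content of the crux lives on arithmetic varieties
of dimension `n ≥ 4`, in codimensions `2 ≤ p ≤ n/2` — first case `p = 2` on arithmetic fourfolds.
[cite: VoisinHodgeI2002, Thm. 6.25 and Thm. 11.30] [cite: KerrPearlstein2011, §3.1] -/
theorem hcOverNumberFields_iff_deepMiddle :
    BoundaryReadout.HCOverNumberFields ↔
      ∀ ⦃n : ℕ⦄ ⦃X : SchemeOver ℂ⦄, IsSmoothProjective n X →
        (∃ (K : Type) (_ : Field K) (_ : NumberField K) (σ : K →+* ℂ) (X₀ : SchemeOver K),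
          Nonempty (X ≅ (baseChangeHom σ).obj X₀)) →
        ∀ (p : ℕ), 2 ≤ p → 2 * p ≤ n → ∀ (c : complexBetti X (2 * p)), IsRationalClass c →
          IsOfHodgeType n X (2 * p) p p c → c ∈ algebraicClasses X p := by
  refine ⟨fun h n X hX hK p _ _ c hc hpp ↦ (h hX hK).2 p c hc hpp, fun h ↦ ?_⟩
  unfold BoundaryReadout.HCOverNumberFields
  intro n X hX hK
  exact ⟨nonempty_hodgeModel_holds hX,
    fun p c hc hpp ↦ hodgeClasses_algebraic_of_deepMiddle hX (h hX hK) p c hc hpp⟩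

/-- **Corollary: arithmetic varieties of dimension `≤ 3` carry no content of the crux** — restated
through the reduction: if the deep-middle clause holds from dimension `4` on, the crux holds (for
`n ≤ 3` the range `2 ≤ p`, `2p ≤ n` is empty). [cite: VoisinHodgeI2002, Thm. 11.30] -/
theorem hcOverNumberFields_of_deepMiddle_four_le
    (h : ∀ ⦃n : ℕ⦄ ⦃X : SchemeOver ℂ⦄, 4 ≤ n → IsSmoothProjective n X →
      (∃ (K : Type) (_ : Field K) (_ : NumberField K) (σ : K →+* ℂ) (X₀ : SchemeOver K),
        Nonempty (X ≅ (baseChangeHom σ).obj X₀)) →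
      ∀ (p : ℕ), 2 ≤ p → 2 * p ≤ n → ∀ (c : complexBetti X (2 * p)), IsRationalClass c →
        IsOfHodgeType n X (2 * p) p p c → c ∈ algebraicClasses X p) :
    BoundaryReadout.HCOverNumberFields :=
  hcOverNumberFields_iff_deepMiddle.2 fun _ _ hX hK p hp2 hpn c hc hpp ↦
    h (by omega) hX hK p hp2 hpn c hc hpp

end Summit.HodgeConjecture.HodgeConjecture.Theorems

end
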